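import Summits.ResolutionOfSingularities.ResolutionOfSingularities.Theorems.FrobeniusClosingPatchingRelPerfectDepthLegalPointMoveTrace
import Summits.ResolutionOfSingularities.ResolutionOfSingularities.Theorems.FrobeniusClosingPatchingRelPerfectDepthWeightTwoBEnd
import Literature.AlgebraicGeometry.Resolution.HypersurfaceRestriction
import Literature.AlgebraicGeometry.Resolution.BlowupDimension
import Literature.AlgebraicGeometry.Resolution.BlowupsExistence
import Literature.AlgebraicGeometry.Resolution.BlowupsLocal
import HarnessLib

/-!
# Crux `PatchingRelPerfect` (stmt-ResolutionOfSingularities-16161), chain W5.2 — T6-E1b residual `LegalScopedDivisorReduction₃`,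
# PHASE 2 closer (2b), brick B4/A2: STEP A — ONE POINT OF A COSSART–JANNSEN–SAITO CENTRE, LIFTED TO THE AMBIENT THREEFOLD

[OURS · L1 W5.2 · res-L1-w52-stub-1 g4 for B4 «STEP A» (plan-1 NAMING N7; lead-1 `PHASE2-SEPARATION-GAME.md` v2)] Replaces the role
of NO printed item; NOT a statement of the manuscript under review; fact-free.

THE POINT LIFT.  The separation game's STEP A runs Cossart–Jannsen–Saito on the host surface; we carry the ambient state ISO-TOLERANTLY:
a `HostState H D L` on `E` (integral, Noetherian, excellent, `dim ≤ 3`, the running `IsPureWeightedSeq 2`, the curve clause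
`Supp D ∩ Supp M ⊆ {coheight > 1}`) together with an isomorphism `e : V(D) ≅ Z` onto the current CJS surface.  Given a closed point
`ξ ∈ Z` over the trace `Supp T` (`T = M|_{V(D)}`) and ANY blowing up `τ₁ : Z₁ → Z` of `Z` at `ξ`, **`HostState.point_step`** produces the
point move of `E` at `p = ι(e⁻¹ ξ)` (`exists_isBlowup` + A1's `HostState.pointMove`), all state clauses one floor up (A1 §3–§4), and a NEW
identification `e₁ : V(D₁) ≅ Z₁` — from blow-up uniqueness: the strict transform of the host is the blowing up of the host at the point
(B1's `isBlowup_host` + A1's `comap_subschemeι_vanishingIdeal_singleton`), pushed through `e` (`IsBlowup.comp_iso`) and compared with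
`τ₁` (`IsBlowup.unique`) — with the trace bookkeeping: UPPER `Supp T₁ ⊆ (e₁ ≫ τ₁ ≫ e⁻¹)⁻¹ Supp T` and, off the fibre over `ξ`, LOWER
`(e₁ ≫ τ₁ ≫ e⁻¹)⁻¹ Supp T ⊆ Supp T₁` (A1 §5).

AI-written; AI review is weaker than expert review.

## References
* E. Bierstone, D. Grigoriev, P. Milman, J. Włodarczyk, arXiv:1206.3090, §4 Step 2b, Remark (3), Lemma 3.6.4 (4). [BierstoneGrigorievMilmanWlodarczyk2011]
* U. Görtz, T. Wedhorn, *Algebraic Geometry I* (2020), Def. 13.90, Prop. 13.91, Prop. 13.92. [GortzWedhorn2020]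
* V. Cossart, U. Jannsen, S. Saito, LNM 2270 (2020), Thm. 1.4, (6.2) (the sequence being lifted; not used here). [CossartJannsenSaito2020]
-/

-- `Summit.<Summit>.<Sub>.Theorems` with `Sub = Summit` (single-conjunct summit, D-0017)
set_option linter.dupNamespace false

noncomputable section

open CategoryTheory AlgebraicGeometry TopologicalSpace IsLocalRing
open Literature.AlgebraicGeometry.Resolution Scheme.IdealSheafData

namespace Summit.ResolutionOfSingularities.ResolutionOfSingularities.Theorems

universe u

namespace DepthLegal

open WeightTwoB DepthTargets

variable {E : Scheme.{u}}

namespace HostState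

/-! ## §7 Small facts: the host is non-zero; closed points through an isomorphism and a closed immersion -/

section Small

variable [IsLocallyNoetherian E] {H D : E.IdealSheafData} {L : List (E.IdealSheafData × ℕ)} (S : HostState H D L)

include S in
/-- The host of a `HostState` with a point on it is a non-zero ideal (it has an order-one generator there). [folklore] -/
theorem host_ne_bot {p : E} (hpD : p ∈ D.support) : D ≠ ⊥ := by
  intro h
  obtain ⟨v, hv, hv2⟩ := S.hostHyp p hpD
  subst h
  rw [stalkIdeal_bot] at hv
  have hv0 : v = 0 := by simpa using (Ideal.span_singleton_eq_bot.mp hv.symm)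
  exact hv2 (hv0 ▸ Ideal.zero_mem _)

omit [IsLocallyNoetherian E] in
/-- The pre-image of a closed point under an isomorphism is a closed point: `{e⁻¹ ξ} = e⁻¹' {ξ}`. [folklore] -/
theorem singleton_inv_eq {X Z : Scheme.{u}} (e : X ≅ Z) (ξ : Z) : ({e.inv ξ} : Set X) = e.hom ⁻¹' {ξ} := by
  ext y
  simp only [Set.mem_singleton_iff, Set.mem_preimage]
  constructor
  · rintro rfl; exact hom_inv_apply e ξ
  · intro h; rw [← h, inv_hom_apply]

omit [IsLocallyNoetherian E] in
/-- `{e⁻¹ ξ}` is closed when `{ξ}` is. [folklore] -/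
theorem isClosed_singleton_inv {X Z : Scheme.{u}} (e : X ≅ Z) {ξ : Z} (hξ : IsClosed ({ξ} : Set Z)) :
    IsClosed ({e.inv ξ} : Set X) := by
  rw [singleton_inv_eq]; exact hξ.preimage e.hom.continuous

omit [IsLocallyNoetherian E] in
/-- The image of a closed point of `V(D)` in `E` is a closed point. [folklore] -/
theorem isClosed_singleton_subschemeι {x : D.subscheme} (hx : IsClosed ({x} : Set D.subscheme)) :
    IsClosed ({D.subschemeι x} : Set E) := by
  rw [← Set.image_singleton]
  exact D.subschemeι.isClosedEmbedding.isClosedMap _ hx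

end Small

/-! ## §8 The point step: one closed point of a CJS centre, lifted -/

section PointStep

variable [IsIntegral E] [IsNoetherian E] {E₀ : Scheme.{u}} {ρ : E ⟶ E₀} {H₀ : E₀.IdealSheafData} {H D : E.IdealSheafData}
  {L : List (E.IdealSheafData × ℕ)} (S : HostState H D L)

include S in
/-- [OURS · L1 W5.2] **THE POINT STEP OF THE STEP A TRANSPORT** (module docstring): given the state on `E` with `e : V(D) ≅ Z`, a
closed point `ξ ∈ Z` over the trace, and any blowing up `τ₁ : Z₁ → Z` at `ξ`, the point move of `E` at `ι(e⁻¹ξ)` carries every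
state clause one floor up and comes with `e₁ : V(D₁) ≅ Z₁` and the UPPER/LOWER trace bookkeeping along `e₁ ≫ τ₁`.
[cite: BierstoneGrigorievMilmanWlodarczyk2011, §4 Step 2b, Remark (3)] [cite: GortzWedhorn2020, Prop. 13.91, Prop. 13.92] -/
theorem point_step (hseq : IsPureWeightedSeq 2 ρ H₀ H) (hexc : Scheme.IsExcellent E) (hdim : topologicalKrullDim E ≤ 3)
    (hcurve : ∀ x ∈ D.support, x ∈ (monomialIdeal L).support → 1 < Order.coheight x)
    {Z : Scheme.{u}} (e : D.subscheme ≅ Z) {ξ : Z} (hξ : IsClosed ({ξ} : Set Z))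
    (hξT : e.inv ξ ∈ (((monomialIdeal L).comap D.subschemeι).support : Set D.subscheme))
    {Z₁ : Scheme.{u}} {τ₁ : Z₁ ⟶ Z} (hτ₁ : IsBlowup τ₁ (vanishingIdeal ⟨{ξ}, hξ⟩)) :
    ∃ (E₁ : Scheme.{u}) (_ : IsIntegral E₁) (_ : IsNoetherian E₁) (ρ₁ : E₁ ⟶ E₀) (H₁ D₁ : E₁.IdealSheafData)
      (L₁ : List (E₁.IdealSheafData × ℕ)) (_ : HostState H₁ D₁ L₁) (e₁ : D₁.subscheme ≅ Z₁),
      IsPureWeightedSeq 2 ρ₁ H₀ H₁ ∧ Scheme.IsExcellent E₁ ∧ topologicalKrullDim E₁ ≤ 3 ∧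
      (∀ x ∈ D₁.support, x ∈ (monomialIdeal L₁).support → 1 < Order.coheight x) ∧
      (∀ y : D₁.subscheme, y ∈ (((monomialIdeal L₁).comap D₁.subschemeι).support : Set D₁.subscheme) →
          e.inv (τ₁ (e₁.hom y)) ∈ (((monomialIdeal L).comap D.subschemeι).support : Set D.subscheme)) ∧
      (∀ y : D₁.subscheme, τ₁ (e₁.hom y) ≠ ξ →
          e.inv (τ₁ (e₁.hom y)) ∈ (((monomialIdeal L).comap D.subschemeι).support : Set D.subscheme) →
            y ∈ (((monomialIdeal L₁).comap D₁.subschemeι).support : Set D₁.subscheme)) := by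
  -- the point `p = ι(e⁻¹ ξ)` of `E`
  set x : D.subscheme := e.inv ξ with hxdef
  set p : E := D.subschemeι x with hpdef
  have hxc : IsClosed ({x} : Set D.subscheme) := isClosed_singleton_inv e hξ
  have hp : IsClosed ({p} : Set E) := isClosed_singleton_subschemeι hxc
  have hpD : p ∈ D.support := subschemeι_apply_mem_support D x
  have hpM : p ∈ (monomialIdeal L).support := by
    have h := hξT
    rw [Scheme.IdealSheafData.support_comap, Closeds.coe_preimage] at h
    exact h
  -- the point move of `E` at `p`
  obtain ⟨E₁, τE, hτE⟩ := exists_isBlowup E (vanishingIdeal ⟨{p}, hp⟩)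
  haveI : IsLocallyNoetherian E₁ := hτE.isLocallyNoetherian
  have S₁ := S.pointMove hp hpD hpM hτE
  have hseq₁ := S.pointMove_cons hp hseq hpD hpM hτE
  have hD0 : D ≠ ⊥ := S.host_ne_bot hpD
  haveI : IsIntegral E₁ := isIntegral_pointMove hp (vanishingIdeal_singleton_ne_bot_of_mem hp hD0 hpD) hτE
  haveI : IsNoetherian E₁ := isNoetherian_pointMove hp hτE
  have hexc₁ : Scheme.IsExcellent E₁ := isExcellent_pointMove hp hexc hτE
  have hdim₁ : topologicalKrullDim E₁ ≤ 3 := hτE.topologicalKrullDim_le hdim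
  have hcurve₁ := S.curve_pointMove hp hcurve hpD hpM hτE
  -- the strict transform of the host over the host, a blowing up at `x`
  obtain ⟨πX, hπX⟩ := exists_hom_subscheme_controlledTransform τE (vanishingIdeal ⟨{p}, hp⟩) D
  have hπXbl : IsBlowup πX (vanishingIdeal ⟨{x}, hxc⟩) := by
    have h := S.isBlowup_host (S.isRegular_subscheme_singleton hp) (Set.singleton_subset_iff.mpr hpD) hτE πX hπX
    rwa [comap_subschemeι_vanishingIdeal_singleton hp rfl hxc] at h
  -- through `e`: `πX ≫ e` is a blowing up of `Z` at `ξ`; compare with `τ₁`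
  have hbl : IsBlowup (πX ≫ e.hom) (vanishingIdeal ⟨{ξ}, hξ⟩) := by
    have h := hπXbl.comp_iso e
    have hI : (vanishingIdeal (⟨{x}, hxc⟩ : Closeds D.subscheme)).comap e.inv = vanishingIdeal ⟨{ξ}, hξ⟩ := by
      rw [show e.inv = e.symm.hom from rfl, comap_hom_vanishingIdeal e.symm]
      congr 1
      apply Closeds.ext
      change e.symm.hom ⁻¹' ({x} : Set D.subscheme) = {ξ}
      rw [hxdef, singleton_inv_eq e ξ, ← Set.preimage_comp]
      change (fun z => e.hom (e.inv z)) ⁻¹' ({ξ} : Set Z) = {ξ}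
      ext z
      simp only [Set.mem_preimage, Set.mem_singleton_iff, hom_inv_apply]
    rwa [hI] at h
  obtain ⟨e₁, he₁, -⟩ := hbl.unique hτ₁
  -- the square `e₁ ≫ τ₁ = πX ≫ e`, pointwise and pulled back through `e⁻¹`
  have hsq : ∀ y : (controlledTransform τE (vanishingIdeal ⟨{p}, hp⟩) D 1).subscheme, e.inv (τ₁ (e₁.hom y)) = πX y := by
    intro y
    have h := congrArg (fun φ => φ y) he₁
    simp only [Scheme.Hom.comp_apply] at h
    change τ₁ (e₁.hom y) = e.hom (πX y) at h
    rw [h, inv_hom_apply]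
  refine ⟨E₁, inferInstance, inferInstance, τE ≫ ρ, _, _, _, S₁, e₁, hseq₁, hexc₁, hdim₁, hcurve₁, fun y hy => ?_,
    fun y hne hy => ?_⟩
  · -- UPPER
    rw [hsq]
    exact S.support_trace_pointMove_subset hp hpM hτE πX hπX hy
  · -- LOWER, off the fibre over `ξ`
    rw [hsq] at hy
    have hne' : τE ((controlledTransform τE (vanishingIdeal ⟨{p}, hp⟩) D 1).subschemeι y) ≠ p := by
      intro h
      apply hne
      -- `ι (πX y) = τE (ι₁ y) = p = ι x`, so `πX y = x` and `τ₁ (e₁ y) = e (πX y) = e x = ξ`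
      have h1 : D.subschemeι (πX y) = p := by
        rw [← Scheme.Hom.comp_apply, hπX, Scheme.Hom.comp_apply]; exact h
      have h2 : πX y = x := D.subschemeι.isClosedEmbedding.injective (h1.trans hpdef)
      have h3 := hsq y
      rw [h2, hxdef] at h3
      -- `e.inv (τ₁ (e₁ y)) = e.inv ξ`
      have h4 := congrArg e.hom h3
      rwa [hom_inv_apply, hom_inv_apply] at h4
    exact (S.mem_support_trace_pointMove_iff hp hpM hτE πX hπX hne').mpr hy

end PointStep

end HostState

end DepthLegal

end Summit.ResolutionOfSingularities.ResolutionOfSingularities.Theorems
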